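import Summits.ABC.ABC.Theses.DefiniteXi
import Literature.NumberTheory.Automorphic.CDTTheorem712
import Literature.NumberTheory.Automorphic.LanglandsTunnellModThree
import HarnessLib

/-!
# Stub ideas for `stub_modThree` (k = 3, gen 2, FAMILY 3 — probe the extremes / perturb from the
proved neighbouring case): the **3–2 switch**.

Typed helper statements (planner sketch; the only `sorry` is the S-sized helper `fourTransfer`, whose
written-out proof — `stub_nineTransfer` with `3 ↦ 2` — is in the session folder's `SketchFourTransfer.lean`).
Companion of `STUB-IDEAS-stub_modThree-3.md` (k = 3, gen 2).
Namespace kept disjoint from the registered skeleton `…Cruxes.FreyModularity.Sketch`.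
-/

set_option linter.dupNamespace false

noncomputable section

open scoped MatrixGroups NumberField

open Literature.NumberTheory.EllipticCurves
open Literature.NumberTheory.Automorphic
open Literature.NumberTheory.Automorphic.BCDT
open Literature.NumberTheory.GaloisRepresentations
open Literature.NumberTheory.DiophantineGeometry
open WeierstrassCurve IsDedekindDomain

namespace Summit.ABC.ABC.Cruxes.FreyModularity.StubIdeasModThree3

/-- The verbatim signature of the registered stub `stub_modThree`. -/
abbrev SigStubModThree : Prop :=
  ∀ (W : WeierstrassCurve ℚ) [W.IsElliptic] (ρ : ModPGaloisRep ℚ (ZMod 3) 2),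
    W.IsTorsionGaloisRep 3 ρ → FramedRep.IsAbsolutelyIrreducible ρ → ρ.IsModular

/-! ## N1 — Allen's 2-adic residually dihedral modularity theorem, the corollary for curves over `ℚ` -/

/-- **Named fact N1 (Allen 2014, Corollary, `F = ℚ`).**  An elliptic curve `E/ℚ` with
(1) `v₂(j_E) ≤ 0` (potentially multiplicative or potentially ordinary at `2`), (2) no rational
`2`-torsion point and `Δ` not a square in `ℚ` (so `ρ̄_{E,2}` has image `S₃ ≅ GL₂(𝔽₂)`: absolutely
irreducible and DIHEDRAL, induced from `L = ℚ(√Δ)`), (3) if `Δ < 0` then `Δ` is not a square in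
`ℚ₂`, is modular.  Residual modularity inside the proof is Hecke's (induction of a character of
`G_L`), NOT Langlands–Tunnell. [cite: Allen2014, Corollary (Introduction) and §5.3] -/
def allen_corollary_rat : Prop :=
  ∀ (W : WeierstrassCurve ℚ) [W.IsElliptic] [NeZero (W.conductorNorm ℤ)],
    padicValRat 2 W.j ≤ 0 →
    (∀ x : ℚ, ¬ W.twoTorsionPolynomial.toPoly.IsRoot x) →
    ¬ IsSquare W.Δ →
    (W.Δ < 0 → ¬ IsSquare (W.Δ : ℚ_[2])) →
    BCDT.IsModular W

/-! ## N2 — the 3–2 switch inside the Rubin–Silverberg pencil `X_E(3) ≅ ℙ¹` -/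

/-- **Named fact N2 (the `3`–`2` switch).**  If `E/ℚ` is semistable at `2` (`4 ∤ N_E`) and `ρ̄` is a
framed model of `E[3]`, there is `E''/ℚ` with `E''[3] ≅ E[3]` (the SAME framed `ρ̄`), `v₂(j(E'')) ≤ 0`,
no rational `2`-torsion, `Δ(E'') > 0` and not a square — i.e. `E''` satisfies Allen's hypotheses with
`L = ℚ(√Δ)` real.  Source of truth: the explicit family `ℰ_t` of Rubin–Silverberg (Thm. 4.1: `ℰ_t[3] ≅
E[3]` for all `t ∈ ℚ`), weak approximation on `ℙ¹`, and three local facts at `2`, at two auxiliary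
good primes `r, s ≡ 2 (mod 3)` (odd `a_r` ⇒ no rational `2`-torsion; `#Ẽ(𝔽_s) ≡ 2 (mod 4)` ⇒ `Δ`
non-square) and at `∞`.  FALSE without `4 ∤ N_E` (Frey witness `E_(3,2)`, `Φ₂ ⊇ Q₈`).
[cite: RubinSilverberg1995, Thm. 4.1 and Remark 4.2] [cite: SilverbergCSS1997, Thm. 2.1, §4] -/
def three_two_switch : Prop :=
  ∀ (W : WeierstrassCurve ℚ) [W.IsElliptic] (ρ : ModPGaloisRep ℚ (ZMod 3) 2),
    W.IsTorsionGaloisRep 3 ρ → ¬ 4 ∣ W.conductorNorm ℤ →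
    ∃ (W'' : WeierstrassCurve ℚ) (_ : W''.IsElliptic),
      W''.IsTorsionGaloisRep 3 ρ ∧ padicValRat 2 W''.j ≤ 0 ∧
      (∀ x : ℚ, ¬ W''.twoTorsionPolynomial.toPoly.IsRoot x) ∧ ¬ IsSquare W''.Δ ∧ 0 < W''.Δ

/-- The short Weierstrass curve `y² = x³ + a x + b`. -/
def shortCurve (a b : ℚ) : WeierstrassCurve ℚ := ⟨0, 0, 0, a, b⟩

/-- Rubin–Silverberg's `a(t)` (Thm. 4.1), `J = j(E)/1728 = 4a³/(4a³+27b²)`. -/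
def rsA (a b t : ℚ) : ℚ :=
  let J := 4 * a ^ 3 / (4 * a ^ 3 + 27 * b ^ 2)
  (-3 * (J - 1) ^ 2 * t ^ 4 - 8 * (J - 1) ^ 2 * t ^ 3 + 6 * (J - 1) * t ^ 2 + 1) * a

/-- Rubin–Silverberg's `b(t)` (Thm. 4.1). -/
def rsB (a b t : ℚ) : ℚ :=
  let J := 4 * a ^ 3 / (4 * a ^ 3 + 27 * b ^ 2)
  (-(J - 1) ^ 3 * (8 * J + 1) * t ^ 6 + 6 * (J - 1) ^ 2 * (2 * J + 1) * t ^ 5 + 15 * (J - 1) ^ 2 * t ^ 4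
    + 20 * (J - 1) ^ 2 * t ^ 3 - 15 * (J - 1) * t ^ 2 + 6 * t + 1) * b

/-- The Rubin–Silverberg pencil `ℰ_t : y² = x³ + a(t) x + b(t)` through `E = ℰ_0`. -/
def rsCurve (a b t : ℚ) : WeierstrassCurve ℚ := shortCurve (rsA a b t) (rsB a b t)

/-- **Named fact B1 (Rubin–Silverberg 1995, Thm. 4.1): the pencil has constant mod-`3`
representation.**  For every `t ∈ ℚ` with `ℰ_t` nonsingular, `ℰ_t[3] ≅ E[3]` as `G_ℚ`-modules; in the
framed vocabulary: every framed model of `E[3]` is one of `ℰ_t[3]`.  (A symbolic identity of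
`3`-division polynomials — certificate-style.) [cite: RubinSilverberg1995, Thm. 4.1] -/
def rubinSilverberg_three : Prop :=
  ∀ (a b t : ℚ) [(shortCurve a b).IsElliptic] [(rsCurve a b t).IsElliptic]
    (ρ : ModPGaloisRep ℚ (ZMod 3) 2),
    (shortCurve a b).IsTorsionGaloisRep 3 ρ → (rsCurve a b t).IsTorsionGaloisRep 3 ρ

/-! ## H-A — the semistable-at-2 regime of the stub, Langlands–Tunnell-free -/

/-- **H-A (XS glue, proved): `ρ̄_{E,3}` is modular for every `E` semistable at `2`**, from N1 + N2:
`E''` is modular by Allen, and `ρ̄ = ρ̄_{E'',3}` is modular by the tree's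
`IsModular.isModular_of_isTorsionGaloisRep''`.  No irreducibility hypothesis is needed. -/
theorem isModular_modThree_of_not_four_dvd (hA : allen_corollary_rat) (hS : three_two_switch) :
    ∀ (W : WeierstrassCurve ℚ) [W.IsElliptic] (ρ : ModPGaloisRep ℚ (ZMod 3) 2),
      W.IsTorsionGaloisRep 3 ρ → ¬ 4 ∣ W.conductorNorm ℤ → ρ.IsModular := by
  intro W _ ρ hρ h4
  obtain ⟨W'', hW'', hρ'', hj, h2t, hsq, hpos⟩ := hS W ρ hρ h4
  haveI := hW''
  haveI : NeZero (W''.conductorNorm ℤ) := ⟨(conductorNorm_pos_holds W'').ne'⟩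
  haveI : Fact (Nat.Prime 3) := ⟨Nat.prime_three⟩
  have hmod : BCDT.IsModular W'' := hA W'' hj h2t hsq fun hneg ↦ absurd hpos (not_lt.mpr hneg.le)
  exact hmod.isModular_of_isTorsionGaloisRep'' hρ''

/-! ## H-B — semistability at `2` transfers along `E'[5] ≅ E[5]` (call site (ii) of the composition) -/

/-- **H-B (S): `4 ∤ N_E` transfers along a common framed model of `E[5]`, `E'[5]`** (Silverberg, CSS
1997, Prop. 7.1(a), `N = 5`, `ℓ = 2`).  The proof is `Summit.ABC.ABC.Theorems.stub_nineTransfer`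
(p110220) with `3 ↦ 2`, written out in full in `SketchFourTransfer.lean` (its three lemmas
`sq_dvd_conductorNorm_iff_hasAdditiveReductionAt`, `exists_ne_zero_smul_eq_of_not_hasAdditiveReductionAt`,
`stub_nineTransfer_torsion` are generic in the place). [cite: SilverbergCSS1997, Prop. 7.1] -/
theorem fourTransfer :
    ∀ (W W' : WeierstrassCurve ℚ) [W.IsElliptic] [W'.IsElliptic] (ρ : ModPGaloisRep ℚ (ZMod 5) 2),
      W.IsTorsionGaloisRep 5 ρ → W'.IsTorsionGaloisRep 5 ρ →
      ¬ 4 ∣ W.conductorNorm ℤ → ¬ 4 ∣ W'.conductorNorm ℤ := by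
  sorry

/-! ## The extremal residual ("Tunnell core") and the regime assembly -/

/-- **The Tunnell core**: `ρ̄_{E,3}` modular for `E` ADDITIVE at `2` (`4 ∣ N_E`) with `ρ̄_{E,3}`
onto `GL₂(𝔽₃)` (projectively octahedral).  For Frey curves, `4 ∣ N` forces `ρ̄_{E,3}(I₂) ⊇ Q₈`
(`stub_swanOddNonabelian`), so no congruent curve is nearly ordinary at `2` and no `2`-adic
dihedral engine applies; inhabited by `E_(3,2)` (`2 + 3 = 5`, `N = 480`, `a₇ = 0`, transvection
at `5`).  This is what remains of Langlands–Tunnell for the line. [cite: Tunnell1981] -/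
def tunnellCore : Prop :=
  ∀ (W : WeierstrassCurve ℚ) [W.IsElliptic] (ρ : ModPGaloisRep ℚ (ZMod 3) 2),
    W.IsTorsionGaloisRep 3 ρ → 4 ∣ W.conductorNorm ℤ → Function.Surjective ρ → ρ.IsModular

/-- The core is no harder than today's closure: it follows from the tree's `langlands_tunnell`. -/
theorem tunnellCore_of_langlands_tunnell (hLT : ∀ σ : FramedArtinRep ℚ 2, langlands_tunnell σ) :
    tunnellCore :=
  fun W _ ρ hρ _ hs ↦ W.isModular_of_isTorsionGaloisRep_three_of_langlands_tunnell hLT ρ hρ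
    (isAbsIrreducibleOverSqrt_neg_three_of_surjective ρ hs).isAbsolutelyIrreducible

/-- **H-C (XS glue, proved): the stub from its three regimes** — semistable at `2` (H-A: Allen +
switch, Tunnell-free), non-surjective absolutely irreducible image (dihedral: gen-1 plan H5 / k = 2
Plan A, Hecke), and the Tunnell core. -/
theorem sig_of_regimes
    (h2 : ∀ (W : WeierstrassCurve ℚ) [W.IsElliptic] (ρ : ModPGaloisRep ℚ (ZMod 3) 2),
      W.IsTorsionGaloisRep 3 ρ → ¬ 4 ∣ W.conductorNorm ℤ → ρ.IsModular)
    (hdih : ∀ (W : WeierstrassCurve ℚ) [W.IsElliptic] (ρ : ModPGaloisRep ℚ (ZMod 3) 2),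
      W.IsTorsionGaloisRep 3 ρ → FramedRep.IsAbsolutelyIrreducible ρ → ¬ Function.Surjective ρ →
      ρ.IsModular)
    (hcore : tunnellCore) : SigStubModThree := by
  intro W _ ρ hρ habs
  by_cases h4 : 4 ∣ W.conductorNorm ℤ
  · by_cases hs : Function.Surjective ρ
    · exact hcore W ρ hρ h4 hs
    · exact hdih W ρ hρ habs hs
  · exact h2 W ρ hρ h4

/-- **The assembled plan**: N1 + N2 + dihedral + core ⇒ the verbatim stub. -/
theorem stub_modThree_of_plan (hA : allen_corollary_rat) (hS : three_two_switch)
    (hdih : ∀ (W : WeierstrassCurve ℚ) [W.IsElliptic] (ρ : ModPGaloisRep ℚ (ZMod 3) 2),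
      W.IsTorsionGaloisRep 3 ρ → FramedRep.IsAbsolutelyIrreducible ρ → ¬ Function.Surjective ρ →
      ρ.IsModular)
    (hcore : tunnellCore) : SigStubModThree :=
  sig_of_regimes (isModular_modThree_of_not_four_dvd hA hS) hdih hcore

end Summit.ABC.ABC.Cruxes.FreyModularity.StubIdeasModThree3

end
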